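import Summits.NavierStokesRegularity.NavierStokesRegularity.Theorems.TerminalTraceTypeITraceScarL3LogMeanZoomRate
import Summits.NavierStokesRegularity.NavierStokesRegularity.Theorems.TerminalTraceTypeITraceScarL3LogMeanZoomFatou
import HarnessLib

/-!
# T28-C storey (B2), zoom lemmas IV: the log-mean datum (LM_q) of a blow-up at `(T, x₀)` passes to ANY
# `L³_loc` zoom limit as an a.e. rate with the same log-window bound
# (item `TerminalTrace.TypeITraceScarL3`, stmt-NavierStokesRegularity-18385, Stub LOUD line; helper)

Seat nsreg-C26-p1 g2 (cell ns-regularity-ideate), `--supports stmt-NavierStokesRegularity-18385` (helper);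
ROUND-28 §3 T28-C (nsreg-p2 g29), DIRECTOR-NS #130 (2).

* `setLIntegral_Ioo_comp_add_left` — `∫⁻_{]s',s[} g(T + σ) dσ = ∫⁻_{]T+s', T+s[} g`.
* **`exists_aeLogMeanRate_of_zoomData`** — let `u` be continuous on `[0,T) × ℝ³`, `b` measurable with
  `‖u(t, x)‖ ≤ b(t)` for `T − δ_b < t < T`, `|x − x₀| < ρ_b`, and
  `∫⁻_{]t',t[} b² ≤ ofReal(2q·log((T−t')/(T−t)) + K₀)` for `T − δ_b < t' ≤ t < T`; let `μ_j → 0⁺` and let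
  `U` be the `L³(Q(a))`-limit (every `a`) of the zooms `μ_j u(T + μ_j²·, x₀ + μ_j·)` — e.g. the zoom data of
  `exists_extinctApex_zoomData_unit_const`.  Then there is `β : ℝ → ℝ` with `‖U(s, y)‖ ≤ β(s)` for a.e.
  `(s, y) ∈ ℝ₋ × ℝ³` and `∫⁻_{]s',s[} ofReal(β²) ≤ ofReal(2q·log((−s')/(−s)) + K₀)` for ALL `s' ≤ s < 0` —
  exactly the rate hypotheses of `one_le_logMean_of_quietShell_of_aeRate` / `no_topSingular_of_aeLogMean_lt_one`.
  Proof: translate to the vertex (`v(s, y) = u(T+s, x₀+y)`, `b_v = b(T+·)`, windows by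
  `setLIntegral_Ioo_comp_add_left`), one a.e.-convergent subsequence and the `liminf` rate
  (`ae_liminfRate_of_zoomLimit_of_ball`), Fatou + scale invariance (`setLIntegral_liminfRate_sq_le`),
  `β := toReal ∘ β_∞` (finite a.e. by the window bounds).

WHAT THIS IS NOT: not the final T28-C statement (next file: plug into the unit-viscosity apex construction),
not NS regularity. [folklore; AlbrittonBarker2019 §3]
-/

noncomputable section

set_option linter.dupNamespace false

namespace Summit.NavierStokesRegularity.NavierStokesRegularity.Theorems.TypeITraceScarL3

open MeasureTheory Set Function Filter Topology TopologicalSpace Metric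
open Literature.Analysis Literature.Analysis.FluidPDE
open scoped NNReal ENNReal

/-- Translation in a `lintegral` over an open interval. [folklore] -/
theorem setLIntegral_Ioo_comp_add_left (g : ℝ → ℝ≥0∞) (T s' s : ℝ) :
    ∫⁻ σ in Ioo s' s, g (T + σ) = ∫⁻ τ in Ioo (T + s') (T + s), g τ := by
  have h1 : ∫⁻ σ in Ioo s' s, g (T + σ) = ∫⁻ σ, (Ioo (T + s') (T + s)).indicator g (T + σ) := by
    rw [← lintegral_indicator measurableSet_Ioo]
    congr 1
    funext σ
    simp only [indicator]
    by_cases h : σ ∈ Ioo s' s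
    · have h' : T + σ ∈ Ioo (T + s') (T + s) := ⟨by linarith [h.1], by linarith [h.2]⟩
      rw [if_pos h, if_pos h']
    · have h' : T + σ ∉ Ioo (T + s') (T + s) := fun h'' => h ⟨by linarith [h''.1], by linarith [h''.2]⟩
      rw [if_neg h, if_neg h']
  rw [h1, lintegral_add_left_eq_self, lintegral_indicator measurableSet_Ioo]

/-- **The log-mean datum passes to the zoom limit** (module docstring). [folklore; AlbrittonBarker2019 §3] -/
theorem exists_aeLogMeanRate_of_zoomData {T : ℝ} (hT : 0 < T)
    {u : ℝ → EuclideanSpace ℝ (Fin 3) → EuclideanSpace ℝ (Fin 3)}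
    (hu : ContinuousOn (uncurry u) (Ico 0 T ×ˢ (univ : Set (EuclideanSpace ℝ (Fin 3)))))
    (x₀ : EuclideanSpace ℝ (Fin 3)) {b : ℝ → ℝ} (hbm : Measurable b) {δb ρb q K₀ : ℝ}
    (hδb : 0 < δb) (hρb : 0 < ρb)
    (hb : ∀ t ∈ Ioo (T - δb) T, ∀ x ∈ ball x₀ ρb, ‖u t x‖ ≤ b t)
    (hLM : ∀ t' t : ℝ, T - δb < t' → t' ≤ t → t < T →
      ∫⁻ τ in Ioo t' t, ENNReal.ofReal (b τ ^ 2) ≤ ENNReal.ofReal (2 * q * Real.log ((T - t') / (T - t)) + K₀))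
    {μ : ℕ → ℝ} (hμ : ∀ j, 0 < μ j) (hμ0 : Tendsto μ atTop (𝓝 0))
    {U : ℝ → EuclideanSpace ℝ (Fin 3) → EuclideanSpace ℝ (Fin 3)}
    (hU : ∀ a : ℝ, 0 < a →
      AEStronglyMeasurable (uncurry U)
        (volume.restrict (parabolicCylinder a (0 : ℝ × EuclideanSpace ℝ (Fin 3)))) ∧
      Tendsto (fun j => eLpNorm
          (uncurry ((μ j) • stPull ((μ j) ^ 2) (μ j) T x₀ u) - uncurry U) 3
          (volume.restrict (parabolicCylinder a (0 : ℝ × EuclideanSpace ℝ (Fin 3)))))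
        atTop (𝓝 0)) :
    ∃ β : ℝ → ℝ,
      (∀ᵐ z ∂(volume.restrict (Iio (0 : ℝ) ×ˢ (univ : Set (EuclideanSpace ℝ (Fin 3))))),
        ‖U z.1 z.2‖ ≤ β z.1) ∧
      ∀ s' s : ℝ, s' ≤ s → s < 0 →
        ∫⁻ σ in Ioo s' s, ENNReal.ofReal (β σ ^ 2) ≤
          ENNReal.ofReal (2 * q * Real.log ((-s') / (-s)) + K₀) := by
  -- ### the vertex frame
  set v : ℝ → EuclideanSpace ℝ (Fin 3) → EuclideanSpace ℝ (Fin 3) := fun s y => u (T + s) (x₀ + y) with hv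
  set bv : ℝ → ℝ := fun s => b (T + s) with hbv
  have hbvm : Measurable bv := hbm.comp (measurable_const.add measurable_id)
  have hzoom : ∀ c : ℝ, c • stPull (c ^ 2) c T x₀ u =
      c • stPull (c ^ 2) c (0 : ℝ) (0 : EuclideanSpace ℝ (Fin 3)) v := by
    intro c
    funext s y
    simp only [Pi.smul_apply, stPull, hv, zero_add]
  have hratev : ∀ s ∈ Ioo (-δb) 0, ∀ y ∈ ball (0 : EuclideanSpace ℝ (Fin 3)) ρb, ‖v s y‖ ≤ bv s := by
    intro s hs y hy
    refine hb (T + s) ⟨by linarith [hs.1], by linarith [hs.2]⟩ (x₀ + y) ?_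
    rw [mem_ball_zero_iff] at hy
    rwa [mem_ball, dist_eq_norm, add_sub_cancel_left]
  have hLMv : ∀ t' t : ℝ, -δb < t' → t' ≤ t → t < 0 →
      ∫⁻ τ in Ioo t' t, ENNReal.ofReal (bv τ ^ 2) ≤
        ENNReal.ofReal (2 * q * Real.log ((-t') / (-t)) + K₀) := by
    intro t' t h1 h2 h3
    rw [hbv, setLIntegral_Ioo_comp_add_left (fun τ => ENNReal.ofReal (b τ ^ 2)) T t' t]
    have h := hLM (T + t') (T + t) (by linarith) (by linarith) (by linarith)
    have e1 : T - (T + t') = -t' := by ring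
    have e2 : T - (T + t) = -t := by ring
    rwa [e1, e2] at h
  -- ### measurability of the zooms on `Q(a)` (eventually `μ_j² a² ≤ T`) and the convergence in the vertex frame
  have hvm : ∀ a : ℝ, 0 < a → ∀ᶠ j in atTop, AEStronglyMeasurable
      (uncurry ((μ j) • stPull ((μ j) ^ 2) (μ j) (0 : ℝ) (0 : EuclideanSpace ℝ (Fin 3)) v))
      (volume.restrict (parabolicCylinder a (0 : ℝ × EuclideanSpace ℝ (Fin 3)))) := by
    intro a ha
    have hev : ∀ᶠ j in atTop, μ j < Real.sqrt T / a := hμ0 (Iio_mem_nhds (by positivity))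
    filter_upwards [hev] with j hj
    have hμj := hμ j
    have h1 : (μ j) ^ 2 * a ^ 2 ≤ T := by
      have h2 : μ j * a < Real.sqrt T := by rwa [lt_div_iff₀ ha] at hj
      have h3 : (μ j * a) ^ 2 < (Real.sqrt T) ^ 2 := pow_lt_pow_left₀ h2 (by positivity) two_ne_zero
      rw [mul_pow, Real.sq_sqrt hT.le] at h3
      exact h3.le
    refine ContinuousOn.aestronglyMeasurable ?_ (isOpen_parabolicCylinder _ _).measurableSet
    rw [← hzoom]
    -- `(s, y) ↦ μ u(T + μ² s, x₀ + μ y)` is continuous on `Q(a)`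
    have hmap : Continuous fun z : ℝ × EuclideanSpace ℝ (Fin 3) => (T + (μ j) ^ 2 * z.1, x₀ + (μ j) • z.2) :=
      (continuous_const.add (continuous_const.mul continuous_fst)).prodMk
        (continuous_const.add (continuous_snd.const_smul (μ j)))
    have hinto : MapsTo (fun z : ℝ × EuclideanSpace ℝ (Fin 3) => (T + (μ j) ^ 2 * z.1, x₀ + (μ j) • z.2))
        (parabolicCylinder a (0 : ℝ × EuclideanSpace ℝ (Fin 3))) (Ico 0 T ×ˢ univ) := by
      intro z hz
      rw [SuitableCompactness.mem_parabolicCylinder_zero] at hz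
      refine ⟨⟨?_, ?_⟩, mem_univ _⟩
      · have h4 : -a ^ 2 < z.1 := hz.1.1
        nlinarith [pow_pos hμj 2]
      · have h5 : z.1 < 0 := hz.1.2
        nlinarith [pow_pos hμj 2]
    have hcomp : ContinuousOn (fun z : ℝ × EuclideanSpace ℝ (Fin 3) =>
        uncurry u (T + (μ j) ^ 2 * z.1, x₀ + (μ j) • z.2))
        (parabolicCylinder a (0 : ℝ × EuclideanSpace ℝ (Fin 3))) := hu.comp hmap.continuousOn hinto
    refine ((continuousOn_const (c := μ j)).smul hcomp).congr fun z _ => ?_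
    simp only [uncurry, Pi.smul_apply, stPull]
    rfl
  have hlim : ∀ a : ℝ, 0 < a →
      AEStronglyMeasurable (uncurry U)
        (volume.restrict (parabolicCylinder a (0 : ℝ × EuclideanSpace ℝ (Fin 3)))) ∧
      Tendsto (fun j => eLpNorm
          (uncurry ((μ j) • stPull ((μ j) ^ 2) (μ j) (0 : ℝ)
            (0 : EuclideanSpace ℝ (Fin 3)) v) - uncurry U) 3
          (volume.restrict (parabolicCylinder a (0 : ℝ × EuclideanSpace ℝ (Fin 3)))))
        atTop (𝓝 0) := by
    intro a ha
    refine ⟨(hU a ha).1, ?_⟩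
    simpa only [hzoom] using (hU a ha).2
  -- ### one subsequence, the `liminf` rate, Fatou
  obtain ⟨φ, hφ, hae⟩ := ae_liminfRate_of_zoomLimit_of_ball hδb hρb hratev hμ hμ0 hvm hlim
  have hφtop : Tendsto φ atTop atTop := tendsto_atTop_mono hφ tendsto_id
  have hlam : ∀ k, 0 < μ (φ k) := fun k => hμ _
  have hlam0 : Tendsto (fun k => μ (φ k)) atTop (𝓝 0) := hμ0.comp hφtop
  set βE : ℝ → ℝ≥0∞ := fun σ =>
    liminf (fun k => ENNReal.ofReal (μ (φ k) * bv ((μ (φ k)) ^ 2 * σ))) atTop with hβE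
  have hwin : ∀ s' s : ℝ, s' ≤ s → s < 0 →
      ∫⁻ σ in Ioo s' s, βE σ ^ 2 ≤ ENNReal.ofReal (2 * q * Real.log ((-s') / (-s)) + K₀) :=
    fun s' s hle hs => setLIntegral_liminfRate_sq_le hbvm hδb hLMv hlam hlam0 hle hs
  have hβEm : Measurable βE :=
    Measurable.liminf fun k =>
      (measurable_const.mul (hbvm.comp (measurable_const.mul measurable_id))).ennreal_ofReal
  -- ### `β_∞ < ∞` a.e. on `ℝ₋`, hence on the slab
  have hfin : ∀ᵐ σ ∂(volume.restrict (Iio (0 : ℝ))), βE σ < ⊤ := by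
    have hcover : Iio (0 : ℝ) ⊆ ⋃ n : ℕ, Ioo (-((n : ℝ) + 2)) (-((n : ℝ) + 2)⁻¹) := by
      intro σ hσ
      have hσ' : σ < 0 := hσ
      obtain ⟨n, hn⟩ := exists_nat_ge (max (-σ) (-σ)⁻¹)
      refine mem_iUnion.2 ⟨n, ?_, ?_⟩
      · have h1 : -σ ≤ n := (le_max_left _ _).trans hn
        linarith
      · have h2 : (-σ)⁻¹ ≤ n := (le_max_right _ _).trans hn
        have h3 : (-σ)⁻¹ < (n : ℝ) + 2 := by linarith
        have h4 : ((n : ℝ) + 2)⁻¹ < -σ := by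
          rw [inv_lt_comm₀ (by positivity) (by linarith)]; exact h3
        linarith
    refine ae_restrict_of_ae_restrict_of_subset hcover ?_
    rw [ae_restrict_iUnion_iff]
    intro n
    have hle : -((n : ℝ) + 2) ≤ -((n : ℝ) + 2)⁻¹ := by
      have h1 : ((n : ℝ) + 2)⁻¹ ≤ 1 := inv_le_one_of_one_le₀ (by linarith)
      linarith
    have hneg : -((n : ℝ) + 2)⁻¹ < 0 := by
      have : (0 : ℝ) < ((n : ℝ) + 2)⁻¹ := by positivity
      linarith
    have hI : ∫⁻ σ in Ioo (-((n : ℝ) + 2)) (-((n : ℝ) + 2)⁻¹), βE σ ^ 2 ≠ ⊤ :=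
      ne_top_of_le_ne_top ENNReal.ofReal_ne_top (hwin _ _ hle hneg)
    have h2 : ∀ᵐ σ ∂(volume.restrict (Ioo (-((n : ℝ) + 2)) (-((n : ℝ) + 2)⁻¹))), βE σ ^ 2 < ⊤ :=
      ae_lt_top' (hβEm.pow_const 2).aemeasurable hI
    filter_upwards [h2] with σ hσ
    by_contra htop
    rw [not_lt, top_le_iff] at htop
    rw [htop, ENNReal.top_pow two_ne_zero] at hσ
    exact lt_irrefl _ hσ
  have hfinSlab : ∀ᵐ z ∂(volume.restrict (Iio (0 : ℝ) ×ˢ (univ : Set (EuclideanSpace ℝ (Fin 3))))),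
      βE z.1 < ⊤ := by
    have h1 : ∀ᵐ z ∂((volume.restrict (Iio (0 : ℝ))).prod (volume : Measure (EuclideanSpace ℝ (Fin 3)))),
        βE z.1 < ⊤ := (Measure.quasiMeasurePreserving_fst).ae hfin
    rw [← Measure.restrict_univ (μ := (volume : Measure (EuclideanSpace ℝ (Fin 3)))),
      Measure.prod_restrict, ← Measure.volume_eq_prod] at h1
    exact h1
  -- ### the real rate `β = toReal ∘ β_∞`
  refine ⟨fun σ => (βE σ).toReal, ?_, ?_⟩
  · filter_upwards [hae, hfinSlab] with z hz hzfin
    have h1 : ‖U z.1 z.2‖ₑ ≤ βE z.1 := hz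
    rw [← toReal_enorm]
    exact ENNReal.toReal_mono hzfin.ne h1
  · intro s' s hle hs
    refine (lintegral_mono fun σ => ?_).trans (hwin s' s hle hs)
    rw [ENNReal.ofReal_pow ENNReal.toReal_nonneg]
    exact pow_le_pow_left' ENNReal.ofReal_toReal_le 2

end Summit.NavierStokesRegularity.NavierStokesRegularity.Theorems.TypeITraceScarL3

end
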